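import Summits.KontsevichZagierPeriods.KontsevichZagierPeriods.Theorems.RootDecompWalshStrataConicBands
import Summits.KontsevichZagierPeriods.KontsevichZagierPeriods.Theorems.RootDecompWalshStrataBall4Disc
import Literature.NumberTheory.Transcendental.KZProductIdeal

/-!
# Root decomposition on Walsh strata — part 104 (gen 13): caps and base of the face-cut 4-ball

Crux `QuadricSignKernel` (item 25393), slice `d = 4`.  The FACE-CUT BALLS
`C_ρ = (0,1)⁴ ∩ {Σ xᵢ² < ρ}`, `1 < ρ ≤ 2`, are the first `d = 4` quadric cells whose values
(`π·arctan √(ρ−1) + …`) leave the `π`-polynomial sector; gen 13 descends them INSIDE THE RULES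
into the `π`-isotypic Baker sector `[hq]·B` (part 103).  `C_ρ` is the positive orthant of the
ball of radius `√ρ` minus the four CAPS `K_i(ρ) = {x | xⱼ > 0, x_i ≥ 1, Σxⱼ² < ρ}` (part 106).
This part sets up the cap `[K_i(ρ), q]` (`capRep`), the translated planar base
`T(ρ) = {(y, y₁) | y ≥ 0, y₁ > 0, (1+y)² + y₁² < ρ}` with its RATIONAL planar representation
`tRep = [T(ρ), q·(ρ − (1+y)² − y₁²)]` (a `ConicDescent.lenRep`), and the source of the cap chart:
the product `srcRep = tRep × [unit quarter disc, 1]` (part 105 is the chart, part 107 the descent).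
[KontsevichZagier2001 §1.1, §4.1; BCR1998 §2.1]
-/

noncomputable section

open Literature.NumberTheory.Transcendental
open MeasureTheory Set
open MvPolynomial (aeval X C)
open Literature.ModelTheory.ExponentialFields (IsSemialgebraic isSemialgebraic_setOf_eval_pos
  isSemialgebraic_setOf_eval_nonneg isSemialgebraic_setOf_eval_lt)
open Summit.KontsevichZagierPeriods.RootDecompWalshStrata.WalshSpanProof (cellRep cellRep_domain
  cellRep_integrand isSemialgebraic_cubeSet isBounded_cubeSet)
open Summit.KontsevichZagierPeriods.RootDecompWalshStrata.ConeSpecimen (discPoly aeval_discPoly)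
open Summit.KontsevichZagierPeriods.RootDecompWalshStrata.ConicDescent (bddRep bddRep_domain bddRep_integrand
  lenRep)

namespace Summit.KontsevichZagierPeriods.RootDecompWalshStrata.CutBall4

variable {ρ : ℚ}

/-! #### The caps `K_i(ρ)` -/

/-- `nsq x = x₀² + x₁² + x₂² + x₃²`. -/
def nsq (x : Fin 4 → ℝ) : ℝ := x 0 ^ 2 + x 1 ^ 2 + x 2 ^ 2 + x 3 ^ 2

/-- The CAP `K_i(ρ) = {x | xⱼ > 0 ∀ j, x_i ≥ 1, Σ xⱼ² < ρ}` of the positive orthant of the ball of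
radius `√ρ` beyond the face `x_i = 1` of the unit cube (closed on that face). -/
def capSet (ρ : ℚ) (i : Fin 4) : Set (Fin 4 → ℝ) := {x | (∀ j, 0 < x j) ∧ 1 ≤ x i ∧ nsq x < ρ}

/-- Membership in a cap, unfolded. [definition] -/
theorem mem_capSet {i : Fin 4} {x : Fin 4 → ℝ} :
    x ∈ capSet ρ i ↔ (∀ j, 0 < x j) ∧ 1 ≤ x i ∧ nsq x < ρ := Iff.rfl

/-- The set `{x | xⱼ > 0 ∀ j}` is `ℚ`-semialgebraic. [BCR1998 §2.1] -/
theorem isSemialgebraic_posSet : IsSemialgebraic ℚ {x : Fin 4 → ℝ | ∀ j, 0 < x j} := by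
  have h := IsSemialgebraic.biInter (k := ℚ) (R := ℝ) (Finset.univ : Finset (Fin 4))
    (fun a => {t : Fin 4 → ℝ | 0 < aeval t (X a : MvPolynomial (Fin 4) ℚ)})
    (fun a _ => isSemialgebraic_setOf_eval_pos _)
  convert h using 1
  ext t
  simp

/-- The caps are `ℚ`-semialgebraic. [BCR1998 §2.1] -/
theorem isSemialgebraic_capSet (ρ : ℚ) (i : Fin 4) : IsSemialgebraic ℚ (capSet ρ i) := by
  have h2 : IsSemialgebraic ℚ {x : Fin 4 → ℝ | 0 ≤ aeval x (X i - 1 : MvPolynomial (Fin 4) ℚ)} :=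
    isSemialgebraic_setOf_eval_nonneg _
  have h3 : IsSemialgebraic ℚ {x : Fin 4 → ℝ |
      aeval x (X 0 ^ 2 + X 1 ^ 2 + X 2 ^ 2 + X 3 ^ 2 : MvPolynomial (Fin 4) ℚ) <
        aeval x (C ρ : MvPolynomial (Fin 4) ℚ)} :=
    isSemialgebraic_setOf_eval_lt _ _
  convert (isSemialgebraic_posSet.inter h2).inter h3 using 1
  ext x
  simp only [capSet, nsq, mem_inter_iff, mem_setOf_eq, map_sub, map_add, map_pow, map_one,
    MvPolynomial.aeval_X, MvPolynomial.aeval_C, eq_ratCast, sub_nonneg]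
  tauto

/-- A cap lies in the box `[0, 2]⁴` when `ρ ≤ 2` (`xⱼ² < ρ ≤ 2 < 4`). [folklore] -/
theorem capSet_subset_Icc (h2 : ρ ≤ 2) (i : Fin 4) : capSet ρ i ⊆ Icc 0 2 := by
  intro x hx
  obtain ⟨hpos, -, hn⟩ := hx
  have h2' : (ρ : ℝ) ≤ 2 := by exact_mod_cast h2
  rw [nsq] at hn
  have h0 := hpos 0; have h1 := hpos 1; have hx2 := hpos 2; have hx3 := hpos 3
  refine ⟨fun j => (hpos j).le, fun j => ?_⟩
  fin_cases j <;> simp <;> nlinarith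

/-- The caps are bounded. [folklore] -/
theorem isBounded_capSet (h2 : ρ ≤ 2) (i : Fin 4) : Bornology.IsBounded (capSet ρ i) :=
  (isCompact_Icc (a := (0 : Fin 4 → ℝ)) (b := 2)).isBounded.subset (capSet_subset_Icc h2 i)

/-- **`capRep ρ q i = [K_i(ρ), q]`**, the cap with constant rational weight `q` (`ρ ≤ 2`).
[KontsevichZagier2001 §1.1] -/
def capRep (ρ q : ℚ) (h2 : ρ ≤ 2) (i : Fin 4) : KZ.IntegralRep 4 :=
  bddRep (capSet ρ i) (isSemialgebraic_capSet ρ i) (isBounded_capSet h2 i) (fun _ => (q : ℝ))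
    (isSemialgebraicFunOn_ratCast (isSemialgebraic_capSet ρ i) q) |(q : ℝ)| fun _ _ => le_rfl

/-- The domain of `capRep`. [definition] -/
@[simp] theorem capRep_domain (q : ℚ) (h2 : ρ ≤ 2) (i : Fin 4) :
    (capRep ρ q h2 i).domain = capSet ρ i := rfl

/-- The integrand of `capRep`. [definition] -/
@[simp] theorem capRep_integrand (q : ℚ) (h2 : ρ ≤ 2) (i : Fin 4) (x : Fin 4 → ℝ) :
    (capRep ρ q h2 i).integrand x = (q : ℝ) := rfl

/-! #### The translated planar base `T(ρ)` and the planar representation `tRep` -/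

/-- `T(ρ) = {(y, y₁) | 0 ≤ y, 0 < y₁, (1 + y)² + y₁² < ρ}` (the cap's shadow, translated by `x₀ = 1 + y`). -/
def tSet (ρ : ℚ) : Set (Fin 2 → ℝ) := {y | 0 ≤ y 0 ∧ 0 < y 1 ∧ (1 + y 0) ^ 2 + y 1 ^ 2 < ρ}

/-- Membership in `T(ρ)`, unfolded. [definition] -/
theorem mem_tSet {y : Fin 2 → ℝ} : y ∈ tSet ρ ↔ 0 ≤ y 0 ∧ 0 < y 1 ∧ (1 + y 0) ^ 2 + y 1 ^ 2 < ρ :=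
  Iff.rfl

/-- `T(ρ)` is `ℚ`-semialgebraic. [BCR1998 §2.1] -/
theorem isSemialgebraic_tSet (ρ : ℚ) : IsSemialgebraic ℚ (tSet ρ) := by
  have h0 : IsSemialgebraic ℚ {y : Fin 2 → ℝ | 0 ≤ aeval y (X 0 : MvPolynomial (Fin 2) ℚ)} :=
    isSemialgebraic_setOf_eval_nonneg _
  have h1 : IsSemialgebraic ℚ {y : Fin 2 → ℝ | 0 < aeval y (X 1 : MvPolynomial (Fin 2) ℚ)} :=
    isSemialgebraic_setOf_eval_pos _
  have h3 : IsSemialgebraic ℚ {y : Fin 2 → ℝ |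
      aeval y ((1 + X 0) ^ 2 + X 1 ^ 2 : MvPolynomial (Fin 2) ℚ) < aeval y (C ρ : MvPolynomial (Fin 2) ℚ)} :=
    isSemialgebraic_setOf_eval_lt _ _
  convert (h0.inter h1).inter h3 using 1
  ext y
  simp only [tSet, mem_inter_iff, mem_setOf_eq, map_add, map_pow, map_one, MvPolynomial.aeval_X,
    MvPolynomial.aeval_C, eq_ratCast]
  tauto

/-- `T(ρ) ⊆ [0, 1]²` when `ρ ≤ 2` (`(1+y)² < 2 ⇒ y < 1`; `y₁² < 1`). [folklore] -/
theorem tSet_subset_Icc (h2 : ρ ≤ 2) : tSet ρ ⊆ Icc 0 1 := by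
  intro y hy
  obtain ⟨h0, h1, hr⟩ := hy
  have h2' : (ρ : ℝ) ≤ 2 := by exact_mod_cast h2
  refine ⟨fun j => ?_, fun j => ?_⟩ <;> fin_cases j <;> simp <;> nlinarith

/-- The fibre radius squared over the base: `g(y, y₁) = ρ − (1 + y)² − y₁²`. -/
def gB (ρ : ℚ) (y : Fin 2 → ℝ) : ℝ := (ρ : ℝ) - (1 + y 0) ^ 2 - y 1 ^ 2

/-- `g > 0` on `T(ρ)`. [definition] -/
theorem gB_pos {y : Fin 2 → ℝ} (hy : y ∈ tSet ρ) : 0 < gB ρ y := by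
  rw [gB]; linarith [hy.2.2]

/-- `g ≤ 1` on `T(ρ)` when `ρ ≤ 2` (`(1 + y)² ≥ 1`). [folklore] -/
theorem gB_le_one (h2 : ρ ≤ 2) {y : Fin 2 → ℝ} (hy : y ∈ tSet ρ) : gB ρ y ≤ 1 := by
  have h2' : (ρ : ℝ) ≤ 2 := by exact_mod_cast h2
  rw [gB]; nlinarith [hy.1, sq_nonneg (y 1)]

/-- `g` is a `ℚ`-polynomial function on any `ℚ`-semialgebraic planar set. [BCR1998 §2.2] -/
theorem isSemialgebraicFunOn_gB {S : Set (Fin 2 → ℝ)} (hS : IsSemialgebraic ℚ S) :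
    IsSemialgebraicFunOn ℚ S (gB ρ) :=
  (isSemialgebraicFunOn_aeval hS (C ρ - (1 + X 0) ^ 2 - X 1 ^ 2 : MvPolynomial (Fin 2) ℚ)).congr
    fun y _ => by
      simp only [gB, map_sub, map_add, map_pow, map_one, MvPolynomial.aeval_X, MvPolynomial.aeval_C,
        eq_ratCast]

/-- The zero edge is `ℚ`-semialgebraic. [BCR1998 §2.2] -/
theorem isSemialgebraicFunOn_zero {S : Set (Fin 2 → ℝ)} (hS : IsSemialgebraic ℚ S) :
    IsSemialgebraicFunOn ℚ S (fun _ : Fin 2 → ℝ => (0 : ℝ)) := by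
  simpa using isSemialgebraicFunOn_ratCast hS 0

/-- **`tRep ρ q = [T(ρ), q·(ρ − (1+y)² − y₁²)]`** — a RATIONAL planar representation with polynomial
weight (the length representation of the band `0 < z < g(y, y₁)` over `T(ρ)`, `ConicDescent.lenRep`).
[KontsevichZagier2001 §1.1] -/
def tRep (ρ q : ℚ) (h2 : ρ ≤ 2) : KZ.IntegralRep 2 :=
  lenRep (tSet ρ) (isSemialgebraic_tSet ρ) (tSet_subset_Icc h2) (fun _ => (0 : ℝ)) (gB ρ)
    (isSemialgebraicFunOn_zero (isSemialgebraic_tSet ρ)) (isSemialgebraicFunOn_gB (isSemialgebraic_tSet ρ))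
    (fun _ _ => le_rfl) (fun _ hy => (gB_pos hy).le) (fun _ hy => gB_le_one h2 hy) q

/-- The domain of `tRep`. [definition] -/
@[simp] theorem tRep_domain (q : ℚ) (h2 : ρ ≤ 2) : (tRep ρ q h2).domain = tSet ρ := rfl

/-- The integrand of `tRep`. [definition] -/
@[simp] theorem tRep_integrand (q : ℚ) (h2 : ρ ≤ 2) (y : Fin 2 → ℝ) :
    (tRep ρ q h2).integrand y = (q : ℝ) * (gB ρ y - 0) := rfl

/-! #### The source: `tRep × (unit quarter disc)` -/

/-- The source of the cap chart: the product of `tRep ρ q` with the unit quarter disc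
`[(0,1)² ∩ {u₀² + u₁² < 1}, 1]` (dimension `2 + 2`). [KontsevichZagier2001 §4.1] -/
def srcRep (ρ q : ℚ) (h2 : ρ ≤ 2) : KZ.IntegralRep (2 + 2) := (tRep ρ q h2).prod (cellRep discPoly 1)

/-- Membership in the source domain, in coordinates `z = (y, y₁, u₀, u₁)`. [definition] -/
theorem mem_src_iff (q : ℚ) (h2 : ρ ≤ 2) {z : Fin (2 + 2) → ℝ} :
    z ∈ (srcRep ρ q h2).domain ↔
      (0 ≤ z 0 ∧ 0 < z 1 ∧ (1 + z 0) ^ 2 + z 1 ^ 2 < ρ) ∧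
        ((0 < z 2 ∧ z 2 < 1) ∧ (0 < z 3 ∧ z 3 < 1)) ∧ z 2 ^ 2 + z 3 ^ 2 < 1 := by
  have hD : (fun j : Fin 2 => z (Fin.natAdd 2 j)) ∈ (cellRep discPoly 1).domain ↔
      ((0 < z 2 ∧ z 2 < 1) ∧ (0 < z 3 ∧ z 3 < 1)) ∧ 0 < 1 - z 2 ^ 2 - z 3 ^ 2 := by
    rw [cellRep_domain, mem_setOf_eq, Fin.forall_fin_two, aeval_discPoly]
    exact Iff.rfl
  change ((0 ≤ z 0 ∧ 0 < z 1 ∧ (1 + z 0) ^ 2 + z 1 ^ 2 < (ρ : ℝ)) ∧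
    (fun j : Fin 2 => z (Fin.natAdd 2 j)) ∈ (cellRep discPoly 1).domain) ↔ _
  rw [hD]
  constructor
  · rintro ⟨hT, hc, hd⟩
    exact ⟨hT, hc, by linarith⟩
  · rintro ⟨hT, hc, hd⟩
    exact ⟨hT, hc, by linarith⟩

/-- The integrand of the source is `q·(ρ − (1+y)² − y₁²)`. [KontsevichZagier2001 §4.1] -/
theorem srcRep_integrand (q : ℚ) (h2 : ρ ≤ 2) (z : Fin (2 + 2) → ℝ) :
    (srcRep ρ q h2).integrand z = (q : ℝ) * ((ρ : ℝ) - (1 + z 0) ^ 2 - z 1 ^ 2) := by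
  rw [srcRep, KZ.IntegralRep.prod_integrand_eq, KZ.IntegralRep.prodFun_apply, tRep_integrand,
    cellRep_integrand]
  change (q : ℝ) * (((ρ : ℝ) - (1 + z 0) ^ 2 - z 1 ^ 2) - 0) * ((1 : ℚ) : ℝ) = _
  push_cast
  ring

end Summit.KontsevichZagierPeriods.RootDecompWalshStrata.CutBall4

end
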